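import Mathlib
import HarnessLib
import Literature.Analysis.FluidPDE.VectorCalculus
import Summits.NavierStokesRegularity.NavierStokesRegularity.Theorems.UnthreadedRigidityDoorUnthreadedRigidityVirialHornZonalLine
import Summits.NavierStokesRegularity.NavierStokesRegularity.Theorems.UnthreadedRigidityDoorUnthreadedRigidityCoZonalAngular
import Summits.NavierStokesRegularity.NavierStokesRegularity.Theorems.UnthreadedRigidityDoorUnthreadedRigidityCoZonalAxes
import Summits.NavierStokesRegularity.NavierStokesRegularity.Theorems.UnthreadedRigidityDoorUnthreadedRigidityThreadingJetsSeparableWindow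
import Summits.NavierStokesRegularity.NavierStokesRegularity.Theorems.UnthreadedRigidityDoorUnthreadedRigidityVirialHornWedgeEuler
import Summits.NavierStokesRegularity.NavierStokesRegularity.Theorems.UnthreadedRigidityDoorUnthreadedRigidityVirialHornWindowCoeffAnalytic
import Summits.NavierStokesRegularity.NavierStokesRegularity.Theorems.UnthreadedRigidityDoorUnthreadedRigidityVirialHornAnalyticWedge
import Summits.NavierStokesRegularity.NavierStokesRegularity.Theorems.UnthreadedRigidityDoorUnthreadedRigidityVirialHornBridgeWOfInjective

/-!
# W2 door `UnthreadedRigidity` (stmt-NavierStokesRegularity-27585) — ★★ SAME-DEGREE NON-COMMUTATION and `IsotypicWindowRigidityL l 2`, every degree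

Prover file (engine-1 g72, DIRECTOR-NS dss_158 (1) GO as support; `--supports stmt-NavierStokesRegularity-27585 --as helper`; route-independent
imports).  THEOREM (`dependent_of_poissonCommute`): two solid harmonics of the SAME degree `l ≥ 1` that Poisson-commute
(`{Y₁,Y₂} = det[y,∇Y₁,∇Y₂] ≡ 0`) are linearly dependent — equivalently (`pbr_pair_injective`) the bracket is injective on the coefficient
arrays of any linearly independent PAIR of degree-`l` solid harmonics, i.e. bridge W's injectivity at `n = 2` in EVERY degree.
PROOF.  (A) `𝒜(Y₂) ≢ 0`: on the open set `W = {y × ∇Y₂ ≠ 0} ∩ {𝒜(Y₂) ≠ 0}` the transfer law `∇Y₁ = λ∇Y₂ + μy` holds with g71's explicit smooth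
`λ, μ` (`…CoZonalSilence` construction, re-run here); g71's pointwise package (`hessian_transfer`, `transfer_firstIntegrals`, `transfer_euler_lam` —
`Dλ(y) = (l−l)λ = 0` —, `transfer_euler_mu`, `transfer_trace`) and second-order step `transfer_beta_angForm` give `Dλ(R₂) = Dλ(y) = Dλ(τ₂) = 0`, so
`Dλ = 0` on `W` (`frame_resolution`; `fderiv_lam_eq_zero_of_transfer`); on a ball in `W`, `λ ≡ c`, `y × ∇(Y₁ − cY₂) = 0`, and LEMMA R
(`IsSolidHarmonic.eq_zero_of_rot_eventuallyEq_zero`) gives `Y₁ ≡ cY₂`.  (B) `𝒜(Y₂) ≡ 0 ≢ 𝒜(Y₁)`: swap.  (C) both angular forms vanish: both are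
zonal (S-C `angularLemma_holds`), about one axis (CZ-b `zonalAxesMatch_holds`), hence proportional by LEMMA Z (`IsSolidHarmonic.zonal_line`).
CONSEQUENCE ★★ `isotypicWindowRigidityL_two_harmonics : ∀ l ≥ 1, IsotypicWindowRigidityL l 2` — unthreaded windows all of whose slices are
admissible `l`-isotypic data over TWO independent solid harmonics are axisymmetric about one common axis: the per-degree pipeline of ns-crc-p1 g8
(`isotypicWindowRigidityL_of_bracketInjective_at`, which asks injectivity for ALL `n`; here re-composed from the same tree lemmas at `n = 2`:
first-jet silence `fluxJetOne_eq_zero_of_unthreaded_window`, slice wedge law `wedgeVanishesL_of_fluxJetOne_eq_zero`, W₂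
`windowWedge_analytic_profiles`, S-A `analyticWedgeSeparableL_holds`, then `separableWindowRigidityL`).

HONEST LABEL: `n = 2` isotypic windows are SPECIAL data (a restriction of 27585); bridge W for `n ≥ 4` at `l ≥ 4` (W-ii) stays OPEN; the
per-degree all-`n` files (W-i) are ns-crc-p2's; `UnthreadedRigidity` (27585), W2 and NS regularity remain OPEN; nothing here is a statement about
Navier–Stokes regularity.  0 kit.
-/

noncomputable section

-- the summit and its single sub-problem share the name (CONVENTIONS §1), as in every Theorems file
set_option linter.dupNamespace false

namespace Summit.NavierStokesRegularity.NavierStokesRegularity.Theorems.UnthreadedRigidity.CoZonal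

open scoped Topology InnerProductSpace
open Filter Set Metric
open Literature.Analysis.FluidPDE (cross)
open Summit.NavierStokesRegularity.NavierStokesRegularity.Theorems.UnthreadedRigidity.VirialHorn
open Summit.NavierStokesRegularity.NavierStokesRegularity.Theorems.UnthreadedRigidity.ProfileHorn (E3)
open Summit.NavierStokesRegularity.NavierStokesRegularity.Theorems.UnthreadedRigidity.ThreadingJets (contDiff_cross_gradient
  contDiff_angForm fluxJetOne separableWindowRigidityL)

/-! ## §0 Coordinates (private copies) -/

/-- components of the cross product. -/
private theorem cross_apply_zero (u v : E3) : cross u v 0 = u 1 * v 2 - u 2 * v 1 := by simp [cross, cross_apply]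
/-- components of the cross product. -/
private theorem cross_apply_one (u v : E3) : cross u v 1 = u 2 * v 0 - u 0 * v 2 := by simp [cross, cross_apply]
/-- components of the cross product. -/
private theorem cross_apply_two (u v : E3) : cross u v 2 = u 0 * v 1 - u 1 * v 0 := by simp [cross, cross_apply]
/-- the inner product in coordinates. -/
private theorem real_inner_e3 (u v : E3) : ⟪u, v⟫_ℝ = u 0 * v 0 + u 1 * v 1 + u 2 * v 2 := by
  simp [PiLp.inner_apply, Fin.sum_univ_three, mul_comm]
/-- `(y × a) × (y × b) = det[y,a,b] y`. -/
private theorem cross_rot_rot (y a b : E3) : cross (cross y a) (cross y b) = det3 y a b • y := by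
  ext i
  fin_cases i <;> simp only [PiLp.smul_apply, smul_eq_mul, det3] <;> simp [cross_apply_zero, cross_apply_one, cross_apply_two] <;> ring
/-- `X × Z = 0 ⇒ |Z|² X = ⟪Z,X⟫ Z`. -/
private theorem smul_eq_of_cross_eq_zero {X Z : E3} (h : cross X Z = 0) : ⟪Z, Z⟫_ℝ • X = ⟪Z, X⟫_ℝ • Z := by
  have hc : ∀ i : Fin 3, cross X Z i = 0 := fun i => by rw [h]; rfl
  have h0 := hc 0; have h1 := hc 1; have h2 := hc 2
  rw [cross_apply_zero] at h0; rw [cross_apply_one] at h1; rw [cross_apply_two] at h2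
  ext i
  fin_cases i <;> simp only [PiLp.smul_apply, smul_eq_mul, real_inner_e3] <;> simp
  · linear_combination (Z 1) * h2 - (Z 2) * h1
  · linear_combination (-(Z 0)) * h2 + (Z 2) * h0
  · linear_combination (Z 0) * h1 - (Z 1) * h0
/-- `y × v = 0 ⇒ |y|² v = ⟪y,v⟫ y`. -/
private theorem smul_eq_of_cross_self_eq_zero {y v : E3} (h : cross y v = 0) : ⟪y, y⟫_ℝ • v = ⟪y, v⟫_ℝ • y := by
  have h' : cross v y = 0 := by
    have : cross v y = -cross y v := by
      ext i; fin_cases i <;> simp only [PiLp.neg_apply] <;> simp [cross_apply_zero, cross_apply_one, cross_apply_two] <;> ring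
    rw [this, h, neg_zero]
  exact smul_eq_of_cross_eq_zero h'

/-! ## §1 The same-degree engine: the transfer coefficient is locally constant -/

section Engine

variable {l : ℕ} {Y₁ Y₂ : E3 → ℝ} {lam mu : E3 → ℝ}

/-- ★ THE SAME-DEGREE ENGINE: if on an open set `W` off the characteristic set of `Y₂` (`y × ∇Y₂ ≠ 0`) and off `{𝒜(Y₂) = 0}` the transfer law
`∇Y₁ = λ∇Y₂ + μy` holds with `λ ∈ C²`, `μ ∈ C¹`, and `Y₁, Y₂` have the SAME degree, then `Dλ = 0` on `W`: `Dλ(R₂) = 0` (first integrals),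
`Dλ(y) = (l − l)λ = 0` (Euler), `(Dλ·τ₂)𝒜(Y₂) = 0` (g71's second-order step) and the frame `(y, τ₂, R₂)`. -/
theorem fderiv_lam_eq_zero_of_transfer (hY₁ : IsSolidHarmonic l Y₁) (hY₂ : IsSolidHarmonic l Y₂)
    {W : Set E3} (hW : IsOpen W) (hRW : ∀ z ∈ W, cross z (gradient Y₂ z) ≠ 0) (hAW : ∀ z ∈ W, angForm Y₂ z ≠ 0)
    (hF : ∀ z ∈ W, gradient Y₁ z = lam z • gradient Y₂ z + mu z • z)
    (hlam : ∀ z ∈ W, ContDiffAt ℝ 2 lam z) (hmu : ∀ z ∈ W, DifferentiableAt ℝ mu z) :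
    ∀ z ∈ W, fderiv ℝ lam z = 0 := by
  have hev : ∀ z ∈ W, ∀ᶠ x in 𝓝 z, gradient Y₁ x = lam x • gradient Y₂ x + mu x • x := fun z hz => by
    filter_upwards [hW.mem_nhds hz] with x hx using hF x hx
  have hE : ∀ z ∈ W, ∀ w : E3, fderiv ℝ (gradient Y₁) z w = fderiv ℝ lam z w • gradient Y₂ z
      + lam z • fderiv ℝ (gradient Y₂) z w + fderiv ℝ mu z w • z + mu z • w := fun z hz w =>
    hessian_transfer hY₂ (hev z hz) ((hlam z hz).differentiableAt (by simp)) (hmu z hz) w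
  have hFI : ∀ z ∈ W, fderiv ℝ lam z (cross z (gradient Y₂ z)) = 0 ∧ fderiv ℝ mu z (cross z (gradient Y₂ z)) = 0 :=
    fun z hz => transfer_firstIntegrals hY₁ hY₂ (hE z hz) (hRW z hz)
  have hΛy : ∀ z ∈ W, fderiv ℝ lam z z = 0 := fun z hz => by
    have h := transfer_euler_lam hY₁ hY₂ (hF z hz) (hE z hz) (hRW z hz)
    rw [h]; ring
  have hMy : ∀ z ∈ W, fderiv ℝ mu z z = ((l : ℝ) - 2) * mu z := fun z hz =>
    transfer_euler_mu hY₁ hY₂ (hF z hz) (hE z hz) (hRW z hz) (by rw [hΛy z hz]; ring)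
  have hΛg : ∀ z ∈ W, fderiv ℝ lam z (gradient Y₂ z) = -(((l : ℝ) + 1) * mu z) := fun z hz =>
    transfer_trace hY₁ hY₂ (hE z hz) (hMy z hz)
  have hβ : ∀ z ∈ W, fderiv ℝ lam z (cross (cross z (gradient Y₂ z)) z) * angForm Y₂ z = 0 := fun z hz =>
    transfer_beta_angForm (l₁ := l) hY₂ (hlam z hz) (hmu z hz)
      (by filter_upwards [hW.mem_nhds hz] with x hx using hΛg x hx)
      (by filter_upwards [hW.mem_nhds hz] with x hx using (hFI x hx).1) (hFI z hz).2 (hRW z hz)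
  intro z hz
  have hτ : fderiv ℝ lam z (cross (cross z (gradient Y₂ z)) z) = 0 := (mul_eq_zero.1 (hβ z hz)).resolve_right (hAW z hz)
  have hR := (hFI z hz).1
  have hy := hΛy z hz
  have hz0 : z ≠ 0 := ne_zero_of_rot_ne_zero (hRW z hz)
  have hpos : 0 < ⟪z, z⟫_ℝ * ⟪cross z (gradient Y₂ z), cross z (gradient Y₂ z)⟫_ℝ :=
    mul_pos (real_inner_self_pos.2 hz0) (real_inner_self_pos.2 (hRW z hz))
  ext X
  have h := congrArg (fun v : E3 => fderiv ℝ lam z v) (frame_resolution z (gradient Y₂ z) X)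
  simp only [map_add, map_smul, smul_eq_mul, hτ, hR, hy, mul_zero, add_zero] at h
  rw [_root_.zero_apply]
  exact (mul_eq_zero.1 h).resolve_left hpos.ne'

end Engine

/-! ## §2 ★★ Same-degree non-commutation -/

section Main

variable {l : ℕ} {Y₁ Y₂ : E3 → ℝ}

/-- the generic case: `𝒜(Y₂) ≢ 0`. -/
theorem dependent_of_poissonCommute_generic (hY₁ : IsSolidHarmonic l Y₁) (hY₂ : IsSolidHarmonic l Y₂) (hl : 1 ≤ l)
    (hP : PoissonCommute Y₁ Y₂) (hA : ∃ y, angForm Y₂ y ≠ 0) : ∃ c : ℝ, ∀ y, Y₁ y = c * Y₂ y := by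
  have hne₂ : ∃ y, Y₂ y ≠ 0 := by
    by_contra h
    push Not at h
    obtain ⟨y, hy⟩ := hA
    exact hy (ThreadingJets.angForm_eq_zero_of_forall_eq_zero h y)
  -- the open set `U = {R₂ ≠ 0}` and the transfer functions (g71's construction)
  have hUo : IsOpen {z : E3 | cross z (gradient Y₂ z) ≠ 0} := isOpen_ne_fun (continuous_rot hY₂) continuous_const
  obtain ⟨lam, hlam⟩ : ∃ f : E3 → ℝ, f = fun z : E3 =>
      ⟪cross z (gradient Y₁ z), cross z (gradient Y₂ z)⟫_ℝ / ⟪cross z (gradient Y₂ z), cross z (gradient Y₂ z)⟫_ℝ := ⟨_, rfl⟩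
  obtain ⟨mu, hmu⟩ : ∃ f : E3 → ℝ, f = fun z : E3 =>
      (((l : ℝ) * Y₁ z - lam z * ((l : ℝ) * Y₂ z))) / ⟪z, z⟫_ℝ := ⟨_, rfl⟩
  have hF : ∀ z ∈ {z : E3 | cross z (gradient Y₂ z) ≠ 0}, gradient Y₁ z = lam z • gradient Y₂ z + mu z • z := by
    intro z hz
    have hzR : cross z (gradient Y₂ z) ≠ 0 := hz
    have hz0 : z ≠ 0 := ne_zero_of_rot_ne_zero hzR
    have hAA : ⟪cross z (gradient Y₂ z), cross z (gradient Y₂ z)⟫_ℝ ≠ 0 := (real_inner_self_pos.2 hzR).ne'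
    have hQ : ⟪z, z⟫_ℝ ≠ 0 := (real_inner_self_pos.2 hz0).ne'
    have hRR : cross (cross z (gradient Y₁ z)) (cross z (gradient Y₂ z)) = 0 := by
      rw [cross_rot_rot]
      have h0 : det3 z (gradient Y₁ z) (gradient Y₂ z) = 0 := hP z
      rw [h0, zero_smul]
    have h1 := smul_eq_of_cross_eq_zero hRR
    have hR₁ : cross z (gradient Y₁ z) = lam z • cross z (gradient Y₂ z) := by
      have : cross z (gradient Y₁ z) = (⟪cross z (gradient Y₂ z), cross z (gradient Y₂ z)⟫_ℝ)⁻¹ •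
          (⟪cross z (gradient Y₂ z), cross z (gradient Y₂ z)⟫_ℝ • cross z (gradient Y₁ z)) := by
        rw [smul_smul, inv_mul_cancel₀ hAA, one_smul]
      rw [this, h1, smul_smul]
      congr 1
      rw [hlam]
      beta_reduce
      rw [div_eq_inv_mul, real_inner_comm (cross z (gradient Y₁ z)) (cross z (gradient Y₂ z))]
    have hc : cross z (gradient Y₁ z - lam z • gradient Y₂ z) = 0 := by
      have e : cross z (gradient Y₁ z - lam z • gradient Y₂ z) = cross z (gradient Y₁ z) - lam z • cross z (gradient Y₂ z) := by
        ext i; fin_cases i <;> simp only [PiLp.sub_apply, PiLp.smul_apply, smul_eq_mul] <;>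
          simp [cross_apply_zero, cross_apply_one, cross_apply_two] <;> ring
      rw [e, hR₁, sub_self]
    have h2 := smul_eq_of_cross_self_eq_zero hc
    rw [inner_sub_right, real_inner_smul_right, hY₁.inner_self_gradient, hY₂.inner_self_gradient] at h2
    have h3 : gradient Y₁ z - lam z • gradient Y₂ z = mu z • z := by
      have : gradient Y₁ z - lam z • gradient Y₂ z =
          (⟪z, z⟫_ℝ)⁻¹ • (⟪z, z⟫_ℝ • (gradient Y₁ z - lam z • gradient Y₂ z)) := by
        rw [smul_smul, inv_mul_cancel₀ hQ, one_smul]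
      rw [this, h2, smul_smul]
      congr 1
      rw [hmu]
      beta_reduce
      rw [div_eq_inv_mul]
    rw [← h3, add_sub_cancel]
  -- smoothness of `λ` and `μ` on `U`
  have hrot₁ := contDiff_cross_gradient hY₁
  have hrot₂ := contDiff_cross_gradient hY₂
  have hnum : ContDiff ℝ 2 (fun z : E3 => ⟪cross z (gradient Y₁ z), cross z (gradient Y₂ z)⟫_ℝ) :=
    (hrot₁.inner ℝ hrot₂).of_le (by norm_cast)
  have hden : ContDiff ℝ 2 (fun z : E3 => ⟪cross z (gradient Y₂ z), cross z (gradient Y₂ z)⟫_ℝ) :=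
    (hrot₂.inner ℝ hrot₂).of_le (by norm_cast)
  have hlamC : ∀ z ∈ {z : E3 | cross z (gradient Y₂ z) ≠ 0}, ContDiffAt ℝ 2 lam z := by
    intro z hz
    rw [hlam]
    exact hnum.contDiffAt.div hden.contDiffAt (real_inner_self_pos.2 hz).ne'
  have hY₁2 : ContDiff ℝ 2 Y₁ := hY₁.contDiff.of_le (by norm_cast)
  have hY₂2 : ContDiff ℝ 2 Y₂ := hY₂.contDiff.of_le (by norm_cast)
  have hzz : ContDiff ℝ 2 (fun z : E3 => ⟪z, z⟫_ℝ) := contDiff_id.inner ℝ contDiff_id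
  have hmuC : ∀ z ∈ {z : E3 | cross z (gradient Y₂ z) ≠ 0}, DifferentiableAt ℝ mu z := by
    intro z hz
    have hz0 : z ≠ 0 := ne_zero_of_rot_ne_zero hz
    rw [hmu]
    exact (((contDiffAt_const.mul hY₁2.contDiffAt).sub ((hlamC z hz).mul (contDiffAt_const.mul hY₂2.contDiffAt))).div
      hzz.contDiffAt (real_inner_self_pos.2 hz0).ne').differentiableAt (by simp)
  -- the open set `W = U ∩ {𝒜(Y₂) ≠ 0}`, nonempty by LEMMA R
  set W : Set E3 := {z : E3 | cross z (gradient Y₂ z) ≠ 0} ∩ {z : E3 | angForm Y₂ z ≠ 0} with hWdef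
  have hAo : IsOpen {z : E3 | angForm Y₂ z ≠ 0} := isOpen_ne_fun (contDiff_angForm hY₂).continuous continuous_const
  have hWo : IsOpen W := hUo.inter hAo
  obtain ⟨z₀, hz₀A, hz₀R⟩ := exists_rot_ne_zero_of_isOpen hY₂ hl hne₂ hAo hA
  have hz₀W : z₀ ∈ W := ⟨hz₀R, hz₀A⟩
  have hD : ∀ z ∈ W, fderiv ℝ lam z = 0 :=
    fderiv_lam_eq_zero_of_transfer hY₁ hY₂ hWo (fun z hz => hz.1) (fun z hz => hz.2) (fun z hz => hF z hz.1)
      (fun z hz => hlamC z hz.1) (fun z hz => hmuC z hz.1)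
  -- `λ` is constant on a ball around `z₀`
  obtain ⟨r, hr, hball⟩ := Metric.isOpen_iff.1 hWo z₀ hz₀W
  have hconst : ∀ x ∈ ball z₀ r, lam x = lam z₀ := by
    intro x hx
    have hdiff : DifferentiableOn ℝ lam (ball z₀ r) := fun w hw =>
      ((hlamC w (hball hw).1).differentiableAt (by simp)).differentiableWithinAt
    have hzero : ∀ w ∈ ball z₀ r, fderivWithin ℝ lam (ball z₀ r) w = 0 := fun w hw => by
      rw [fderivWithin_of_isOpen isOpen_ball hw]; exact hD w (hball hw)
    exact (convex_ball z₀ r).is_const_of_fderivWithin_eq_zero hdiff hzero hx (mem_ball_self hr)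
  -- the solid harmonic `G = Y₁ − cY₂` has radial gradient on the ball, hence vanishes (LEMMA R)
  set c : ℝ := lam z₀ with hc
  have hGh : IsSolidHarmonic l (fun y => ∑ k : Fin 2, (![1, -c] : Fin 2 → ℝ) k * (![Y₁, Y₂] : Fin 2 → E3 → ℝ) k y) :=
    isSolidHarmonic_comb ![1, -c] ![Y₁, Y₂] (fun k => by fin_cases k <;> simpa using (by first | exact hY₁ | exact hY₂))
  have hGe : (fun y => ∑ k : Fin 2, (![1, -c] : Fin 2 → ℝ) k * (![Y₁, Y₂] : Fin 2 → E3 → ℝ) k y) = fun y => Y₁ y - c * Y₂ y := by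
    funext y; simp [Fin.sum_univ_two]; ring
  rw [hGe] at hGh
  have hgradG : ∀ x : E3, gradient (fun y => Y₁ y - c * Y₂ y) x = gradient Y₁ x - c • gradient Y₂ x := by
    intro x
    have h1 : HasFDerivAt Y₁ (fderiv ℝ Y₁ x) x := ((hY₁.contDiff.differentiable (by simp)) x).hasFDerivAt
    have h2 : HasFDerivAt Y₂ (fderiv ℝ Y₂ x) x := ((hY₂.contDiff.differentiable (by simp)) x).hasFDerivAt
    have h := h1.sub (h2.const_mul c)
    have hG : HasGradientAt (fun y => Y₁ y - c * Y₂ y) (gradient Y₁ x - c • gradient Y₂ x) x := by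
      rw [hasGradientAt_iff_hasFDerivAt]
      refine h.congr_fderiv ?_
      ext v
      simp only [InnerProductSpace.toDual_apply_apply, _root_.sub_apply, _root_.smul_apply, smul_eq_mul, inner_sub_left,
        real_inner_smul_left, gradient, InnerProductSpace.toDual_symm_apply]
    exact hG.gradient
  have hrotG : ∀ᶠ x in 𝓝 z₀, cross x (gradient (fun y => Y₁ y - c * Y₂ y) x) = 0 := by
    filter_upwards [isOpen_ball.mem_nhds (mem_ball_self hr)] with x hx
    rw [hgradG x, hF x (hball hx).1, hconst x hx]
    have : c • gradient Y₂ x + mu x • x - c • gradient Y₂ x = mu x • x := by abel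
    rw [this]
    ext i; fin_cases i <;> simp [cross_apply_zero, cross_apply_one, cross_apply_two] <;> ring
  have hG0 := IsSolidHarmonic.eq_zero_of_rot_eventuallyEq_zero hGh hl hrotG
  exact ⟨c, fun y => by linarith [hG0 y]⟩

/-- ★★ **SAME-DEGREE NON-COMMUTATION**: two solid harmonics of the same degree `l ≥ 1` that Poisson-commute are linearly dependent
(`∃ (c₁, c₂) ≠ (0,0)`, `c₁Y₁ + c₂Y₂ ≡ 0`). -/
theorem dependent_of_poissonCommute (hY₁ : IsSolidHarmonic l Y₁) (hY₂ : IsSolidHarmonic l Y₂) (hl : 1 ≤ l)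
    (hP : PoissonCommute Y₁ Y₂) : ∃ c₁ c₂ : ℝ, (c₁ ≠ 0 ∨ c₂ ≠ 0) ∧ ∀ y, c₁ * Y₁ y + c₂ * Y₂ y = 0 := by
  have hP' : PoissonCommute Y₂ Y₁ := fun y => by
    have := hP y; unfold PoissonCommute pbr at *; rw [show det3 y (gradient Y₂ y) (gradient Y₁ y)
      = -det3 y (gradient Y₁ y) (gradient Y₂ y) by simp only [det3]; ring, this, neg_zero]
  by_cases hA₂ : ∃ y, angForm Y₂ y ≠ 0
  · obtain ⟨c, hc⟩ := dependent_of_poissonCommute_generic hY₁ hY₂ hl hP hA₂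
    exact ⟨1, -c, Or.inl one_ne_zero, fun y => by rw [hc y]; ring⟩
  by_cases hA₁ : ∃ y, angForm Y₁ y ≠ 0
  · obtain ⟨c, hc⟩ := dependent_of_poissonCommute_generic hY₂ hY₁ hl hP' hA₁
    exact ⟨-c, 1, Or.inr one_ne_zero, fun y => by rw [hc y]; ring⟩
  -- both angular forms vanish: both zonal (S-C), common axis (CZ-b), proportional (LEMMA Z)
  push Not at hA₁ hA₂
  by_cases hne₁ : ∃ y, Y₁ y ≠ 0
  swap
  · push Not at hne₁
    exact ⟨1, 0, Or.inl one_ne_zero, fun y => by rw [hne₁ y]; ring⟩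
  by_cases hne₂ : ∃ y, Y₂ y ≠ 0
  swap
  · push Not at hne₂
    exact ⟨0, 1, Or.inr one_ne_zero, fun y => by rw [hne₂ y]; ring⟩
  obtain ⟨a, ha, hza⟩ := angularLemma_holds l Y₁ hY₁ hA₁
  obtain ⟨b, hb, hzb⟩ := angularLemma_holds l Y₂ hY₂ hA₂
  have hza₂ : IsZonalAbout a Y₂ := zonalAxesMatch_holds l l Y₁ Y₂ a b hl hl hY₁ hY₂ hne₁ hne₂ ha hb hza hzb hP
  have hline := hY₁.zonal_line hY₂ ha hza hza₂
  -- `Y₁(a) ≠ 0` (else `Y₁ ≡ 0` by LEMMA Z)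
  have hY₁a : Y₁ a ≠ 0 := by
    intro h0
    obtain ⟨y, hy⟩ := hne₁
    exact hy (IsSolidHarmonic.eq_zero_of_isZonalAbout_of_apply_axis l Y₁ hY₁ ha hza h0 y)
  exact ⟨Y₂ a, -Y₁ a, Or.inr (neg_ne_zero.2 hY₁a), fun y => by rw [hline y]; ring⟩

/-- ★ **BRACKET INJECTIVITY FOR PAIRS, EVERY DEGREE** (bridge W's injectivity hypothesis at `n = 2`): for a linearly independent pair of solid
harmonics of degree `l ≥ 1`, `Σ w_{mm′}{B_m,B_{m′}} ≡ 0` forces `w` symmetric. -/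
theorem pbr_pair_injective (l : ℕ) (hl : 1 ≤ l) (B : Fin 2 → E3 → ℝ) (hB : ∀ m, IsSolidHarmonic l (B m))
    (hBi : LinearIndependent ℝ B) (w : Fin 2 → Fin 2 → ℝ)
    (hw : ∀ y : E3, ∑ m, ∑ m', w m m' * pbr (B m) (B m') y = 0) : ∀ m m', w m m' = w m' m := by
  -- the coefficient sum is `(w₀₁ − w₁₀)·{B₀,B₁}`
  have hsum : ∀ y : E3, (w 0 1 - w 1 0) * pbr (B 0) (B 1) y = 0 := by
    intro y
    have h := hw y
    simp only [Fin.sum_univ_two, pbr_self, mul_zero, zero_add, add_zero, pbr_swap (B 1) (B 0)] at h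
    linarith
  by_cases hd : w 0 1 = w 1 0
  · intro m m'
    fin_cases m <;> fin_cases m' <;> first | rfl | exact hd | exact hd.symm
  · exfalso
    have hP : PoissonCommute (B 0) (B 1) := fun y =>
      (mul_eq_zero.1 (hsum y)).resolve_left (sub_ne_zero.2 hd)
    obtain ⟨c₁, c₂, hc, hrel⟩ := dependent_of_poissonCommute (hB 0) (hB 1) hl hP
    have hli := Fintype.linearIndependent_iff.1 hBi ![c₁, c₂] (by
      funext y
      simp only [Fin.sum_univ_two, Pi.smul_apply, smul_eq_mul, Pi.zero_apply, Matrix.cons_val_zero,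
        Matrix.cons_val_one, Finset.sum_apply]
      exact hrel y)
    have h0 := hli 0; have h1 := hli 1
    simp at h0 h1
    rcases hc with h | h <;> contradiction

end Main

/-! ## §3 ★★ `IsotypicWindowRigidityL l 2`, every degree -/

/-- ★★ **TWO-HARMONIC ISOTYPIC WINDOWS ARE RIGID, IN EVERY DEGREE**: `IsotypicWindowRigidityL l 2` for all `l ≥ 1` — the conclusion of
`UnthreadedRigidity` (hypotheses verbatim) for unthreaded windows all of whose slices are admissible `l`-isotypic poloidal data over a FIXED
linearly independent PAIR of solid harmonics of degree `l` (time-dependent radial coefficients).  Per-degree pipeline at `n = 2`: first-jet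
silence ⇒ slice wedge law (injectivity supplied by `pbr_pair_injective`) ⇒ W₂ analytic coefficients ⇒ S-A separable ⇒ `separableWindowRigidityL`. -/
theorem isotypicWindowRigidityL_two_harmonics (l : ℕ) (hl : 1 ≤ l) : IsotypicWindowRigidityL l 2 := by
  intro S hS hconn u x₀ hcont hdiv hmild hbdd hunth hiso
  obtain ⟨B, cf, hB, hslice⟩ := hiso
  refine separableWindowRigidityL hl hS hconn hcont hdiv hmild hbdd hunth fun t ht => ?_
  obtain ⟨hadm, hu⟩ := hslice t ht
  have h0 : ∀ x : E3, fluxJetOne (isoShellL 2 (cf t) B x₀) x₀ x = 0 := fun x => by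
    rw [← hu]
    exact fluxJetOne_eq_zero_of_unthreaded_window hS hcont hdiv hmild hbdd hunth ht x
  have hW : WedgeVanishesL 2 (cf t) :=
    wedgeVanishesL_of_fluxJetOne_eq_zero hl hadm x₀ (pbr_pair_injective l hl B hadm.1 hB) h0
  have hA := windowWedge_analytic_profiles l 2 S hl hS u x₀ hcont hdiv hmild hbdd hunth B cf hB hslice t ht
  obtain ⟨H, Y, hH, hY, hHY⟩ := analyticWedgeSeparableL_holds l 2 (cf t) B x₀ hadm hA hW
  exact ⟨H, Y, hH, hY, by rw [hu]; exact hHY⟩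

end Summit.NavierStokesRegularity.NavierStokesRegularity.Theorems.UnthreadedRigidity.CoZonal

end
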